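import Literature.MathematicalPhysics.QuantumFieldTheory.BalabanImbrieJaffe1984to88.BIJ88SlotConnectedGraph310
import Literature.MathematicalPhysics.QuantumFieldTheory.BalabanImbrieJaffe1984to88.BIJ88ConnectedGraphKP310

/-!
# `BalabanImbrieJaffe1984to88.BIJ88SlotConnectedGraph310KP` — T. Bałaban, J. Imbrie, A. Jaffe, *Effective action and cluster properties of the
abelian Higgs model*, Commun. Math. Phys. **114** (1988) 257–315 [BalabanImbrieJaffe1988], Sect. 5.14 pp. 308–310 [PDF 52–54]:
**`Σ_γ ⟨(d/dt)_{γ_{j_1}}; …; (d/dt)_{γ_{j_n}}⟩_t = (d/dt)ⁿ log z_t` and the (5.14.2) remainder in the §5.13 Gaussian model WITH THE DISPLAY-3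
TRUNCATED FUNCTIONS, THE CONVERGENCE HYPOTHESIS `hT` DISCHARGED FROM (5.14.4)** — p36 gen 10's `BIJ88SlotConnectedGraph310` (the knit of the
analytic p. 308 chain with p25's combinatorial p. 310 chain) carried one displayed non-structural hypothesis, the absolute convergence `hT` of the
connected series of p. 310 display 3 in the virtual-support bookkeeping (*"It is now a standard exercise to estimate the expansion, using
(5.14.4)"*); the sibling `BIJ88ConnectedGraphKP310` (gen 11, file 2) proves it from the typed leaf (5.14.4) `Ineq5144` in gen 5's regime.  Here the
two are composed: the gen-10 theorems with `hT` replaced by (5.14.4) FOR THE SLOT DATA OF THE ASSIGNMENTS, plus the bound on the truncated functions.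

statement-level skeleton of published theorems with citation tags; proofs where landed; nothing here is a claim about the Yang–Mills mass gap

PDF held: `paper:balaban1988-cmp114-bij-abelian-higgs-effective-action` (journal page = PDF page + 256); pp. 308–310 = PDF 52–54 read this session
(`p0052.txt` L27 *"We express each d/dt as a sum Σ_γ (d/dt)_γ"*; `p0053.txt` L12–14 (5.14.4); `p0054.txt` L18 display 3, L25 *"standard exercise"*).

WHAT IS REPRODUCED (unit `lit-balaban-p36`, generation 11 of the Phase-2 proof seat p36, file 3 of 3; SKELETON rows **C2.Claim@310** (displays 2–3
and the *"standard exercise"* sentence, member), **C2.Eq5.14.1-5.14.2** ((5.14.2), member), **C2.Eq5.14.3-5.14.4** ((5.14.3)/(5.14.4), member) of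
`HOME/lit-balaban-r16/ROWS-C2-part2.md`; owner r16, heads untouched; HOME `run/shared/lean/pub/lit-balaban/`).  Setting of `BIJ88SlotConnectedGraph310`
verbatim (sites `α` in cubes `blk : α → I`, coupling `Δ`, source `ℱ`, region `W`, abutting relation `adj`; χ-slots `b ∈ B` with fields `Φ_b`,
constants `c_b`, profile `χ`, `p`, `e_k`; term slots `Y ∈ Ys` with terms `V_Y`; slot cubes `cube`; labels `L`, assignments `γ : L → ↥B ⊕ ↥Ys`; slot
data `H ↦ zG blk Δ ℱ (fD (uD … t) cube γ H)`; `T_γ(K) := Tsum` over the virtual supports `(polysOf W).image (cvsupp adj W)`, `locv (cube ∘ γ)`,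
`wv (prime (g3 adj ·))`).  The INPUT replacing `hT`: the typed leaf **(5.14.4) for the prime-dropped activities of the slot data of each
assignment**, `Ineq5144 (cubeSys I) (Finset L) (prime (g3 adj (H ↦ zG … γ H))) card (fun H X => (X ∖ H.image (cube ∘ γ)).card) θ β′` (p25 gen 12's
phrasing), a symmetric `adj` of degree `≤ D` (neighbours `nbr`), `0 < θ ≤ 1`, `0 ≤ β′`, gen 5's regime `16(D+1)²θ^{β′/2}e² ≤ 1`.  Theorems only:
* §1 `summable_norm_Tord_slot_of_ineq5144` (`hT` for the slot data of an assignment), `abs_Tsum_slot_le_of_ineq5144`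
  (`|T_γ(b)| ≤ θ^{(1−β′)|b|}·|b|!·4e²θ^{β′}(D+1)·|W|`);
* §2 `zG_fD_empty_ne_zero_of_ineq5144` (the normalization `≠ 0`, p25's KP zero-freeness `corner_empty_ne_zero_of_ineq5144`),
  **`zG_fD_div_eq_sum_setPartitions_Tsum_of_ineq5144`** (display 2 with the display-3 truncations; gen 10's `hz` AND `hT` discharged),
  **`sum_asg_Tsum_eq_iteratedDeriv_log_zG_of_ineq5144`** / `sum_Tsum_univ_eq_iteratedDeriv_log_zG_of_ineq5144` (on the branch
  `t ∈ s ⊆ (0, e^{−1}/e_k)`: `Σ_{γ ∈ asg s₀ K} T_γ(K) = (d/dt)^{|K|} log z_t`), **`abs_iteratedDeriv_log_zG_le_of_ineq5144`** (hence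
  `|(d/dt)^{|K|} log z_t| ≤ #asg · θ^{(1−β′)|K|}·|K|!·4e²θ^{β′}(D+1)·|W|` — the derivative of `log z_t` is bounded extensively in `|W|`);
* §3 **`remR_sum_Tsum_eq_integral_log_zG_of_ineq5144`** (r16's (5.14.2) remainder `remR` of `Σ_γ T_{γ,t}(L)` equals
  `−(1/(n̄+1)) ∫₀¹ ((1−t)^{n̄}/n̄!) ∂^{n̄+1}_{[0,1]} log z_t dt`, the leaf assumed for `t ∈ (0,1]`), **`abs_remR_sum_Tsum_le_of_ineq5144`**
  (`|remR| ≤ N_s^{n̄+1}·θ^{(1−β′)(n̄+1)}·4e²θ^{β′}(D+1)·|W|`, `N_s` = number of slots: the remainder is `O(|W|)` with the `(n̄+1)`-st power of the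
  vertex factor — the global form of the printed *"The result is |W₆^{(k)′}(X)| ≤ (…)^{n̄+1+β′|X|}"*, no `|X|`-localization).
Of the displayed hypotheses of gens 9–10 (`hN`, `hz`, `hκ`, `hκloc`, `hT`) NONE remains: what is assumed is structural (χ(1,·) ≥ 0, `p ≥ 0`,
`W`-block of `Δ` positive definite, `Δ` couples abutting cubes only, cubes of the slots in `W`, cube-local continuous fields with `Φ_b(0) = 0`,
`c_b ≥ c₀ > 0`, cube-local measurable bounded terms, `e_k > 0` (`< e^{−1}` in §3)) plus the ONE typed leaf (5.14.4) and its regime.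
HONEST SCOPE: (a) (5.14.4) for the slot data is NOT proved (row C2.Eq5.14.3-5.14.4, the analytic pp. 307/309 estimate); (b) finite-dimensional
Gaussian model of §5.13 as in p25's files; (c) the branch `t > 0` only (the `t = 0` end of (5.14.1) is gen 8's centered theory, not threaded);
(d) no `|X|`-localized `W₆′(X)` bound is asserted (gen 5's `BIJ88W6PrimeBound`, plain bookkeeping).  0 `sorry`, 0 definitions, 0 new `Prop` facts
(D-0026); imports `BIJ88SlotConnectedGraph310`, `BIJ88ConnectedGraphKP310`; modifies nothing.  NOT summit progress; NOT continuum; NOT Clay.  Cell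
`lit-balaban` Phase 2, seat p36 gen 11 (owner r16, referee ref-5).
-/

noncomputable section

namespace Literature.MathematicalPhysics.QuantumFieldTheory.BalabanImbrieJaffe1984to88.BIJ88SlotConnectedGraph310KP

open Finset MeasureTheory
open Literature.Probability.LatticeModels (setPartitions)
open Literature.MathematicalPhysics.QuantumFieldTheory.BalabanImbrieJaffe1984to88.BIJ88TruncatedExpectation5142 (asg asg_univ)
open BIJ88PolymerRep5134 (corner)
open BIJ88PolymerRep5134Gauss (prec zG)
open BIJ88Expansion5143 (g3 prime)
open BIJ88PolymerRep5134Gauss (isClusterFactorizing_zG)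
open BIJ88Expansion5143Gauss (fD fD_local fD_slot isSlotLocal_zG)
open BIJ88Expansion5143Ordered (polysOf cvsupp locv wv)
open BIJ88ConnectedGraphResummation (Tsum Tord)
open BIJ88SlotMomentsGauss308 (uD)
open BIJ88SlotConnectedGraph310 (uD_local zG_fD_div_eq_sum_setPartitions_Tsum sum_asg_Tsum_eq_iteratedDeriv_log_zG
  sum_Tsum_univ_eq_iteratedDeriv_log_zG remR_sum_Tsum_eq_integral_log_zG)
open BIJ88ConnectedGraphKP310 (summable_norm_Tord_vsupp_of_ineq5144 abs_Tsum_vsupp_le_of_ineq5144)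
open BIJ88Expansion5143KP (corner_empty_ne_zero_of_ineq5144)
open BIJ88RemainderW6Tsum (kp_smallness_of_regime)
open BIJ88Ineq5113Covering (cubeSys)
open BIJ88Sect5Statements (CutoffProfile)
open BIJ88Sect5StatementsPart2 (Ineq5144)
open BIJ88Sect5StatementsPart4 (remR)

variable {α I : Type} [Fintype α] [DecidableEq α] [Fintype I] [DecidableEq I]
  (blk : α → I) (Δ : Matrix α α ℝ) (ℱ : α → ℝ) (W : Finset I) (adj : I → I → Prop) [DecidableRel adj] {nbr : I → Finset I} {D : ℕ}
variable (χ : CutoffProfile) {ι υ : Type*} [DecidableEq ι] [DecidableEq υ]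
variable {p ek : ℝ} {B : Finset ι} {Φ : ι → (α → ℝ) → ℝ} {c : ι → ℝ} {Ys : Finset υ} {V : υ → (α → ℝ) → ℝ}
variable (cube : ↥B ⊕ ↥Ys → I) {θ β' : ℝ} {L : Type} [Fintype L] [DecidableEq L]

/-! ## §1 `hT` and the bound on the truncated functions, for the slot data of an assignment -/

/-- **`hT` FOR THE SLOT DATA OF AN ASSIGNMENT, FROM (5.14.4)**: if the prime-dropped activities `g₃′` of the slot data of `γ` at time `t` obey the
typed leaf (5.14.4) (vertex factor `0 < θ ≤ 1`, exponent `β′ ≥ 0`) in gen 5's regime `16(D+1)²θ^{β′/2}e² ≤ 1` for a symmetric abutting relation of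
degree `≤ D`, then the connected series of p. 310 display 3 of every nonempty block converges absolutely (`BIJ88ConnectedGraphKP310`).
[cite: BalabanImbrieJaffe1988, (5.14.4) p.309, p.310 (Sect. 5.14)] -/
theorem summable_norm_Tord_slot_of_ineq5144 (hR : ∀ x y, adj x y → adj y x) (hD : ∀ x, (nbr x).card ≤ D)
    (hnbr : ∀ x y, adj x y → y ∈ nbr x) (hθ0 : 0 < θ) (hθ1 : θ ≤ 1) (hβ : 0 ≤ β')
    (hsmall : 16 * ((D : ℝ) + 1) ^ 2 * (θ ^ (β' / 2) * Real.exp 2) ≤ 1) (t : ℝ) (γ : L → ↥B ⊕ ↥Ys)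
    (h5144 : Ineq5144 (cubeSys I) (Finset L) (prime (g3 adj fun H' => zG blk Δ ℱ (fD (uD χ p ek B Φ c Ys V t) cube γ H')))
      Finset.card (fun H (X : Finset I) => (X \ H.image (cube ∘ γ)).card) θ β') :
    ∀ b : Finset L, b.Nonempty → Summable fun m => ‖Tord ((polysOf W).image (cvsupp adj W)) (locv (cube ∘ γ))
      (wv (prime (g3 adj fun H' => zG blk Δ ℱ (fD (uD χ p ek B Φ c Ys V t) cube γ H')))) m b‖ :=
  fun _ hb => summable_norm_Tord_vsupp_of_ineq5144 hR hD hnbr hθ0 hθ1 hβ hsmall h5144 hb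

/-- **the truncated functions of the slot data are bounded**: `|T_γ(b)| ≤ θ^{(1−β′)|b|}·|b|!·4e²θ^{β′}(D+1)·|W|` for every nonempty block `b`.
[cite: BalabanImbrieJaffe1988, (5.14.4) p.309, p.310 (Sect. 5.14)] -/
theorem abs_Tsum_slot_le_of_ineq5144 (hR : ∀ x y, adj x y → adj y x) (hD : ∀ x, (nbr x).card ≤ D)
    (hnbr : ∀ x y, adj x y → y ∈ nbr x) (hθ0 : 0 < θ) (hθ1 : θ ≤ 1) (hβ : 0 ≤ β')
    (hsmall : 16 * ((D : ℝ) + 1) ^ 2 * (θ ^ (β' / 2) * Real.exp 2) ≤ 1) (t : ℝ) (γ : L → ↥B ⊕ ↥Ys)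
    (h5144 : Ineq5144 (cubeSys I) (Finset L) (prime (g3 adj fun H' => zG blk Δ ℱ (fD (uD χ p ek B Φ c Ys V t) cube γ H')))
      Finset.card (fun H (X : Finset I) => (X \ H.image (cube ∘ γ)).card) θ β') {b : Finset L} (hb : b.Nonempty) :
    |Tsum ((polysOf W).image (cvsupp adj W)) (locv (cube ∘ γ))
        (wv (prime (g3 adj fun H' => zG blk Δ ℱ (fD (uD χ p ek B Φ c Ys V t) cube γ H')))) b| ≤
      (θ ^ (1 - β')) ^ b.card * b.card.factorial * (2 * (2 * Real.exp 2 * θ ^ β' * ((D : ℝ) + 1)) * W.card) :=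
  abs_Tsum_vsupp_le_of_ineq5144 hR hD hnbr hθ0 hθ1 hβ hsmall h5144 hb

/-! ## §2 Display 2 with the display-3 truncations, and `Σ_γ T_γ(K) = (d/dt)^{|K|} log z_t`, modulo (5.14.4) -/

omit [Fintype L] in
/-- **the normalization `⟨Π_i fD_t γ ∅ i⟩_{1,W} ≠ 0` FROM (5.14.4)** (p. 310: *"This enables us to factor out the normalization"*): p25's KP
zero-freeness `BIJ88Expansion5143KP.corner_empty_ne_zero_of_ineq5144` for the slot data of `γ` (cluster-factorizing by `hΔ` + cube-locality,
slot-local), the KP smallness following from gen 5's regime (`BIJ88RemainderW6Tsum.kp_smallness_of_regime`).  (In the model with the structural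
positivity hypotheses it is even `> 0` with no smallness: gen 10's `Nsum_vsupp_empty_pos`.) [cite: BalabanImbrieJaffe1988, (5.14.4) p.309, p.310 display 1] -/
theorem zG_fD_empty_ne_zero_of_ineq5144 (hR : ∀ x y, adj x y → adj y x) (hD : ∀ x, (nbr x).card ≤ D)
    (hnbr : ∀ x y, adj x y → y ∈ nbr x) (hθ0 : 0 < θ) (hθ1 : θ ≤ 1) (hβ : 0 ≤ β')
    (hsmall : 16 * ((D : ℝ) + 1) ^ 2 * (θ ^ (β' / 2) * Real.exp 2) ≤ 1)
    (hΔ : ∀ x y, blk x ≠ blk y → ¬ adj (blk x) (blk y) → Δ x y = 0)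
    (hΦloc : ∀ b : B, ∀ φ ψ : α → ℝ, (∀ x, blk x = cube (Sum.inl b) → φ x = ψ x) → Φ b φ = Φ b ψ)
    (hVloc : ∀ Y : Ys, ∀ φ ψ : α → ℝ, (∀ x, blk x = cube (Sum.inr Y) → φ x = ψ x) → V Y φ = V Y ψ) {t : ℝ}
    (γ : L → ↥B ⊕ ↥Ys)
    (h5144 : Ineq5144 (cubeSys I) (Finset L) (prime (g3 adj fun H' => zG blk Δ ℱ (fD (uD χ p ek B Φ c Ys V t) cube γ H')))
      Finset.card (fun H (X : Finset I) => (X \ H.image (cube ∘ γ)).card) θ β') :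
    zG blk Δ ℱ (fD (uD χ p ek B Φ c Ys V t) cube γ ∅) W W ≠ 0 :=
  corner_empty_ne_zero_of_ineq5144 (W := W) (zr := fun H' => zG blk Δ ℱ (fD (uD χ p ek B Φ c Ys V t) cube γ H')) hR hD hnbr hθ0.le
    (kp_smallness_of_regime hθ0 hθ1 hβ hsmall)
    (isClusterFactorizing_zG blk Δ ℱ _ adj hΔ (fD_local blk γ (uD_local blk χ cube hΦloc hVloc t) ∅))
    (isSlotLocal_zG blk Δ ℱ (cube ∘ γ) _ fun H i => fD_slot _ cube γ H i) h5144

/-- **display 2 of p. 310 with the display-3 truncations, for the slot data of `γ`, modulo (5.14.4)**: `⟨Π fD_t γ K⟩/⟨Π fD_t γ ∅⟩ =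
Σ_{π∈𝒫(K)} Π_{b∈π} T_γ(b)` — gen 10's `zG_fD_div_eq_sum_setPartitions_Tsum` with BOTH `hz` and `hT` DISCHARGED; hypotheses: `Δ` couples abutting
cubes only, cubes of the slots in `W`, cube-local fields and terms, and the leaf (5.14.4) in gen 5's regime.
[cite: BalabanImbrieJaffe1988, p.310 displays 1–3; (5.14.3)–(5.14.4) p.309] -/
theorem zG_fD_div_eq_sum_setPartitions_Tsum_of_ineq5144 (hR : ∀ x y, adj x y → adj y x) (hD : ∀ x, (nbr x).card ≤ D)
    (hnbr : ∀ x y, adj x y → y ∈ nbr x) (hθ0 : 0 < θ) (hθ1 : θ ≤ 1) (hβ : 0 ≤ β')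
    (hsmall : 16 * ((D : ℝ) + 1) ^ 2 * (θ ^ (β' / 2) * Real.exp 2) ≤ 1)
    (hΔ : ∀ x y, blk x ≠ blk y → ¬ adj (blk x) (blk y) → Δ x y = 0) (hcube : ∀ τ, cube τ ∈ W)
    (hΦloc : ∀ b : B, ∀ φ ψ : α → ℝ, (∀ x, blk x = cube (Sum.inl b) → φ x = ψ x) → Φ b φ = Φ b ψ)
    (hVloc : ∀ Y : Ys, ∀ φ ψ : α → ℝ, (∀ x, blk x = cube (Sum.inr Y) → φ x = ψ x) → V Y φ = V Y ψ) {t : ℝ}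
    (γ : L → ↥B ⊕ ↥Ys)
    (h5144 : Ineq5144 (cubeSys I) (Finset L) (prime (g3 adj fun H' => zG blk Δ ℱ (fD (uD χ p ek B Φ c Ys V t) cube γ H')))
      Finset.card (fun H (X : Finset I) => (X \ H.image (cube ∘ γ)).card) θ β') (K : Finset L) :
    zG blk Δ ℱ (fD (uD χ p ek B Φ c Ys V t) cube γ K) W W / zG blk Δ ℱ (fD (uD χ p ek B Φ c Ys V t) cube γ ∅) W W =
      ∑ π ∈ setPartitions K, ∏ b ∈ π, Tsum ((polysOf W).image (cvsupp adj W)) (locv (cube ∘ γ))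
        (wv (prime (g3 adj fun H => zG blk Δ ℱ (fD (uD χ p ek B Φ c Ys V t) cube γ H)))) b :=
  zG_fD_div_eq_sum_setPartitions_Tsum blk Δ ℱ W adj χ cube hΔ hcube hΦloc hVloc γ
    (zG_fD_empty_ne_zero_of_ineq5144 blk Δ ℱ W adj χ cube hR hD hnbr hθ0 hθ1 hβ hsmall hΔ hΦloc hVloc γ h5144) fun b _ hb =>
    summable_norm_Tord_slot_of_ineq5144 blk Δ ℱ W adj χ cube hR hD hnbr hθ0 hθ1 hβ hsmall t γ h5144 b hb

/-- **`Σ_{γ ∈ asg s₀ K} T_γ(K) = (d/dt)^{|K|} log z_t` IN THE MODEL, MODULO (5.14.4)** — gen 10's `sum_asg_Tsum_eq_iteratedDeriv_log_zG` with `hT`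
DISCHARGED: on the branch `t ∈ s ⊆ (0, e^{−1}/e_k)` (`s` a set of unique differentiability), for every nonempty `K ⊆ H`, the connected-graph series
of display 3 of the slot data of the assignments of the labels of `K` (others pinned at `s₀`), summed, is the `|K|`-th derivative of `log z_t`;
hypotheses: structural, and (5.14.4) for the slot data of every assignment at time `t` in gen 5's regime.
[cite: BalabanImbrieJaffe1988, (5.14.2) p.308; (5.14.3)–(5.14.4) p.309; p.310 displays 1–3] -/
theorem sum_asg_Tsum_eq_iteratedDeriv_log_zG_of_ineq5144 (hR : ∀ x y, adj x y → adj y x) (hD : ∀ x, (nbr x).card ≤ D)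
    (hnbr : ∀ x y, adj x y → y ∈ nbr x) (hθ0 : 0 < θ) (hθ1 : θ ≤ 1) (hβ : 0 ≤ β')
    (hsmall : 16 * ((D : ℝ) + 1) ^ 2 * (θ ^ (β' / 2) * Real.exp 2) ≤ 1) (hχ : ∀ x, 0 ≤ χ.χ₁ x) (hp : 0 ≤ p)
    (hΔ : ∀ x y, blk x ≠ blk y → ¬ adj (blk x) (blk y) → Δ x y = 0) (hPD : (prec blk Δ W (corner ℝ W)).PosDef)
    (hcube : ∀ τ, cube τ ∈ W)
    (hΦloc : ∀ b : B, ∀ φ ψ : α → ℝ, (∀ x, blk x = cube (Sum.inl b) → φ x = ψ x) → Φ b φ = Φ b ψ)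
    (hVloc : ∀ Y : Ys, ∀ φ ψ : α → ℝ, (∀ x, blk x = cube (Sum.inr Y) → φ x = ψ x) → V Y φ = V Y ψ)
    (hΦc : ∀ b ∈ B, Continuous (Φ b)) (hΦ0 : ∀ b ∈ B, Φ b 0 = 0) {c₀ : ℝ} (hc₀ : 0 < c₀) (hcb : ∀ b ∈ B, c₀ ≤ c b)
    (hV : ∀ Y ∈ Ys, Measurable (V Y)) {KY : υ → ℝ} (hK : ∀ Y ∈ Ys, ∀ φ, |V Y φ| ≤ KY Y) (hek : 0 < ek) {s : Set ℝ}
    (hs : UniqueDiffOn ℝ s) (hsub : s ⊆ Set.Ioo 0 (Real.exp (-1) / ek)) (s₀ : ↥B ⊕ ↥Ys) (γ₀ : L → ↥B ⊕ ↥Ys) {H : Finset L} {t : ℝ}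
    (ht : t ∈ s)
    (h5144 : ∀ γ : L → ↥B ⊕ ↥Ys, Ineq5144 (cubeSys I) (Finset L)
      (prime (g3 adj fun H' => zG blk Δ ℱ (fD (uD χ p ek B Φ c Ys V t) cube γ H')))
      Finset.card (fun H (X : Finset I) => (X \ H.image (cube ∘ γ)).card) θ β') :
    ∀ K ⊆ H, K.Nonempty →
      ∑ γ ∈ asg s₀ K, Tsum ((polysOf W).image (cvsupp adj W)) (locv (cube ∘ γ))
          (wv (prime (g3 adj fun H' => zG blk Δ ℱ (fD (uD χ p ek B Φ c Ys V t) cube γ H')))) K =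
        iteratedDeriv K.card (fun x => Real.log (zG blk Δ ℱ (fD (uD χ p ek B Φ c Ys V x) cube γ₀ ∅) W W)) t :=
  sum_asg_Tsum_eq_iteratedDeriv_log_zG blk Δ ℱ W adj χ cube hχ hp hΔ hPD hcube hΦloc hVloc hΦc hΦ0 hc₀ hcb hV hK hek hs hsub s₀ γ₀ ht
    fun γ b _ hb => summable_norm_Tord_slot_of_ineq5144 blk Δ ℱ W adj χ cube hR hD hnbr hθ0 hθ1 hβ hsmall t γ (h5144 γ) b hb

/-- **All labels, modulo (5.14.4): `Σ_{γ : H → slots} T_γ(H) = (d/dt)ⁿ log z_t`** (`n = |H| ≥ 1`).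
[cite: BalabanImbrieJaffe1988, (5.14.2) p.308; (5.14.4) p.309; p.310 displays 1–3] -/
theorem sum_Tsum_univ_eq_iteratedDeriv_log_zG_of_ineq5144 (hR : ∀ x y, adj x y → adj y x) (hD : ∀ x, (nbr x).card ≤ D)
    (hnbr : ∀ x y, adj x y → y ∈ nbr x) (hθ0 : 0 < θ) (hθ1 : θ ≤ 1) (hβ : 0 ≤ β')
    (hsmall : 16 * ((D : ℝ) + 1) ^ 2 * (θ ^ (β' / 2) * Real.exp 2) ≤ 1) (hχ : ∀ x, 0 ≤ χ.χ₁ x) (hp : 0 ≤ p)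
    (hΔ : ∀ x y, blk x ≠ blk y → ¬ adj (blk x) (blk y) → Δ x y = 0) (hPD : (prec blk Δ W (corner ℝ W)).PosDef)
    (hcube : ∀ τ, cube τ ∈ W)
    (hΦloc : ∀ b : B, ∀ φ ψ : α → ℝ, (∀ x, blk x = cube (Sum.inl b) → φ x = ψ x) → Φ b φ = Φ b ψ)
    (hVloc : ∀ Y : Ys, ∀ φ ψ : α → ℝ, (∀ x, blk x = cube (Sum.inr Y) → φ x = ψ x) → V Y φ = V Y ψ)
    (hΦc : ∀ b ∈ B, Continuous (Φ b)) (hΦ0 : ∀ b ∈ B, Φ b 0 = 0) {c₀ : ℝ} (hc₀ : 0 < c₀) (hcb : ∀ b ∈ B, c₀ ≤ c b)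
    (hV : ∀ Y ∈ Ys, Measurable (V Y)) {KY : υ → ℝ} (hK : ∀ Y ∈ Ys, ∀ φ, |V Y φ| ≤ KY Y) (hek : 0 < ek) {s : Set ℝ}
    (hs : UniqueDiffOn ℝ s) (hsub : s ⊆ Set.Ioo 0 (Real.exp (-1) / ek)) [Nonempty L] (γ₀ : L → ↥B ⊕ ↥Ys) {t : ℝ} (ht : t ∈ s)
    (h5144 : ∀ γ : L → ↥B ⊕ ↥Ys, Ineq5144 (cubeSys I) (Finset L)
      (prime (g3 adj fun H' => zG blk Δ ℱ (fD (uD χ p ek B Φ c Ys V t) cube γ H')))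
      Finset.card (fun H (X : Finset I) => (X \ H.image (cube ∘ γ)).card) θ β') :
    ∑ γ : L → ↥B ⊕ ↥Ys, Tsum ((polysOf W).image (cvsupp adj W)) (locv (cube ∘ γ))
        (wv (prime (g3 adj fun H' => zG blk Δ ℱ (fD (uD χ p ek B Φ c Ys V t) cube γ H')))) univ =
      iteratedDeriv (Fintype.card L) (fun x => Real.log (zG blk Δ ℱ (fD (uD χ p ek B Φ c Ys V x) cube γ₀ ∅) W W)) t :=
  sum_Tsum_univ_eq_iteratedDeriv_log_zG blk Δ ℱ W adj χ cube hχ hp hΔ hPD hcube hΦloc hVloc hΦc hΦ0 hc₀ hcb hV hK hek hs hsub γ₀ ht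
    fun γ b hb => summable_norm_Tord_slot_of_ineq5144 blk Δ ℱ W adj χ cube hR hD hnbr hθ0 hθ1 hβ hsmall t γ (h5144 γ) b hb

/-- **THE DERIVATIVES OF `log z_t` ARE BOUNDED, MODULO (5.14.4)** (the estimate the *"standard exercise"* delivers, summed over the assignments):
on the branch, for nonempty `K ⊆ H`, `|(d/dt)^{|K|} log z_t| ≤ #(asg s₀ K) · θ^{(1−β′)|K|}·|K|!·4e²θ^{β′}(D+1)·|W|` — extensive in the number
`|W|` of cubes, small in the vertex factor. [cite: BalabanImbrieJaffe1988, (5.14.2) p.308; (5.14.4) p.309; p.310 (Sect. 5.14)] -/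
theorem abs_iteratedDeriv_log_zG_le_of_ineq5144 (hR : ∀ x y, adj x y → adj y x) (hD : ∀ x, (nbr x).card ≤ D)
    (hnbr : ∀ x y, adj x y → y ∈ nbr x) (hθ0 : 0 < θ) (hθ1 : θ ≤ 1) (hβ : 0 ≤ β')
    (hsmall : 16 * ((D : ℝ) + 1) ^ 2 * (θ ^ (β' / 2) * Real.exp 2) ≤ 1) (hχ : ∀ x, 0 ≤ χ.χ₁ x) (hp : 0 ≤ p)
    (hΔ : ∀ x y, blk x ≠ blk y → ¬ adj (blk x) (blk y) → Δ x y = 0) (hPD : (prec blk Δ W (corner ℝ W)).PosDef)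
    (hcube : ∀ τ, cube τ ∈ W)
    (hΦloc : ∀ b : B, ∀ φ ψ : α → ℝ, (∀ x, blk x = cube (Sum.inl b) → φ x = ψ x) → Φ b φ = Φ b ψ)
    (hVloc : ∀ Y : Ys, ∀ φ ψ : α → ℝ, (∀ x, blk x = cube (Sum.inr Y) → φ x = ψ x) → V Y φ = V Y ψ)
    (hΦc : ∀ b ∈ B, Continuous (Φ b)) (hΦ0 : ∀ b ∈ B, Φ b 0 = 0) {c₀ : ℝ} (hc₀ : 0 < c₀) (hcb : ∀ b ∈ B, c₀ ≤ c b)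
    (hV : ∀ Y ∈ Ys, Measurable (V Y)) {KY : υ → ℝ} (hK : ∀ Y ∈ Ys, ∀ φ, |V Y φ| ≤ KY Y) (hek : 0 < ek) {s : Set ℝ}
    (hs : UniqueDiffOn ℝ s) (hsub : s ⊆ Set.Ioo 0 (Real.exp (-1) / ek)) (s₀ : ↥B ⊕ ↥Ys) (γ₀ : L → ↥B ⊕ ↥Ys) {H : Finset L} {t : ℝ}
    (ht : t ∈ s)
    (h5144 : ∀ γ : L → ↥B ⊕ ↥Ys, Ineq5144 (cubeSys I) (Finset L)
      (prime (g3 adj fun H' => zG blk Δ ℱ (fD (uD χ p ek B Φ c Ys V t) cube γ H')))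
      Finset.card (fun H (X : Finset I) => (X \ H.image (cube ∘ γ)).card) θ β') {K : Finset L} (hKH : K ⊆ H) (hKne : K.Nonempty) :
    |iteratedDeriv K.card (fun x => Real.log (zG blk Δ ℱ (fD (uD χ p ek B Φ c Ys V x) cube γ₀ ∅) W W)) t| ≤
      (asg s₀ K : Finset (L → ↥B ⊕ ↥Ys)).card *
        ((θ ^ (1 - β')) ^ K.card * K.card.factorial * (2 * (2 * Real.exp 2 * θ ^ β' * ((D : ℝ) + 1)) * W.card)) := by
  rw [← sum_asg_Tsum_eq_iteratedDeriv_log_zG_of_ineq5144 blk Δ ℱ W adj χ cube hR hD hnbr hθ0 hθ1 hβ hsmall hχ hp hΔ hPD hcube hΦloc hVloc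
    hΦc hΦ0 hc₀ hcb hV hK hek hs hsub s₀ γ₀ ht h5144 K hKH hKne]
  refine (abs_sum_le_sum_abs _ _).trans ?_
  calc ∑ γ ∈ asg s₀ K, |Tsum ((polysOf W).image (cvsupp adj W)) (locv (cube ∘ γ))
          (wv (prime (g3 adj fun H' => zG blk Δ ℱ (fD (uD χ p ek B Φ c Ys V t) cube γ H')))) K|
      ≤ ∑ γ ∈ asg s₀ K, (θ ^ (1 - β')) ^ K.card * K.card.factorial * (2 * (2 * Real.exp 2 * θ ^ β' * ((D : ℝ) + 1)) * W.card) :=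
        sum_le_sum fun γ _ => abs_Tsum_slot_le_of_ineq5144 blk Δ ℱ W adj χ cube hR hD hnbr hθ0 hθ1 hβ hsmall t γ (h5144 γ) hKne
    _ = _ := by rw [sum_const, nsmul_eq_mul]

/-! ## §3 r16's (5.14.2) remainder for the family in the model, truncated functions = display 3, modulo (5.14.4) -/

/-- **(5.14.2) IN THE MODEL WITH THE TRUNCATED FUNCTIONS OF DISPLAY 3, MODULO (5.14.4)** — gen 10's `remR_sum_Tsum_eq_integral_log_zG` with `hT`
DISCHARGED: `e_k < e^{−1}`, `|L| = n̄+1` labels; for `⟨d/dt; …; d/dt⟩_t := Σ_{γ : L → slots} T_{γ,t}(L)`, r16's remainder `remR` of (5.14.2) equals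
`−(1/(n̄+1)) ∫₀¹ ((1−t)^{n̄}/n̄!) (d/dt)^{n̄+1} log z_t dt` (derivative within `[0,1]`; the located `(n̄+1)!` slip GAPS G-C2-p36-06); hypotheses:
structural, and (5.14.4) for the slot data of every assignment at every `t ∈ (0,1]` in gen 5's regime.
[cite: BalabanImbrieJaffe1988, (5.14.2) p.308; (5.14.3)–(5.14.4) p.309; p.310 displays 1–3] -/
theorem remR_sum_Tsum_eq_integral_log_zG_of_ineq5144 (hR : ∀ x y, adj x y → adj y x) (hD : ∀ x, (nbr x).card ≤ D)
    (hnbr : ∀ x y, adj x y → y ∈ nbr x) (hθ0 : 0 < θ) (hθ1 : θ ≤ 1) (hβ : 0 ≤ β')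
    (hsmall : 16 * ((D : ℝ) + 1) ^ 2 * (θ ^ (β' / 2) * Real.exp 2) ≤ 1) (hχ : ∀ x, 0 ≤ χ.χ₁ x) (hp : 0 ≤ p)
    (hΔ : ∀ x y, blk x ≠ blk y → ¬ adj (blk x) (blk y) → Δ x y = 0) (hPD : (prec blk Δ W (corner ℝ W)).PosDef)
    (hcube : ∀ τ, cube τ ∈ W)
    (hΦloc : ∀ b : B, ∀ φ ψ : α → ℝ, (∀ x, blk x = cube (Sum.inl b) → φ x = ψ x) → Φ b φ = Φ b ψ)
    (hVloc : ∀ Y : Ys, ∀ φ ψ : α → ℝ, (∀ x, blk x = cube (Sum.inr Y) → φ x = ψ x) → V Y φ = V Y ψ)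
    (hΦc : ∀ b ∈ B, Continuous (Φ b)) (hΦ0 : ∀ b ∈ B, Φ b 0 = 0) {c₀ : ℝ} (hc₀ : 0 < c₀) (hcb : ∀ b ∈ B, c₀ ≤ c b)
    (hV : ∀ Y ∈ Ys, Measurable (V Y)) {KY : υ → ℝ} (hK : ∀ Y ∈ Ys, ∀ φ, |V Y φ| ≤ KY Y) (hek : 0 < ek)
    (hek1 : ek < Real.exp (-1)) {nbar : ℕ} (hL : Fintype.card L = nbar + 1) (γ₀ : L → ↥B ⊕ ↥Ys)
    (h5144 : ∀ t ∈ Set.Ioc (0 : ℝ) 1, ∀ γ : L → ↥B ⊕ ↥Ys, Ineq5144 (cubeSys I) (Finset L)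
      (prime (g3 adj fun H' => zG blk Δ ℱ (fD (uD χ p ek B Φ c Ys V t) cube γ H')))
      Finset.card (fun H (X : Finset I) => (X \ H.image (cube ∘ γ)).card) θ β') :
    remR (fun t => ∑ γ : L → ↥B ⊕ ↥Ys, Tsum ((polysOf W).image (cvsupp adj W)) (locv (cube ∘ γ))
        (wv (prime (g3 adj fun H' => zG blk Δ ℱ (fD (uD χ p ek B Φ c Ys V t) cube γ H')))) univ) nbar =
      -(1 / (nbar + 1 : ℝ)) * ∫ t in (0 : ℝ)..1, ((1 - t) ^ nbar / nbar.factorial) *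
        iteratedDerivWithin (nbar + 1) (fun x => Real.log (zG blk Δ ℱ (fD (uD χ p ek B Φ c Ys V x) cube γ₀ ∅) W W))
          (Set.uIcc 0 1) t :=
  remR_sum_Tsum_eq_integral_log_zG blk Δ ℱ W adj χ cube hχ hp hΔ hPD hcube hΦloc hVloc hΦc hΦ0 hc₀ hcb hV hK hek hek1 hL γ₀
    fun t ht γ b hb => summable_norm_Tord_slot_of_ineq5144 blk Δ ℱ W adj χ cube hR hD hnbr hθ0 hθ1 hβ hsmall t γ (h5144 t ht γ) b hb

/-- **THE (5.14.2) REMAINDER IS `O(|W|)` WITH THE `(n̄+1)`-ST POWER OF THE VERTEX FACTOR, MODULO (5.14.4)** (p. 310: *"The result is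
|W₆^{(k)′}(X)| ≤ (e^β(L^kε/ε₀)^{1/4−α})^{n̄+1+β′|X|}"*, here in the GLOBAL form obtained by summing the block bounds of the truncated functions over the
assignments — no `|X|`-localization): with `|L| = n̄+1` derivative labels and `N_s` slots, r16's remainder satisfies
`|remR (t ↦ Σ_γ T_{γ,t}(L)) n̄| ≤ N_s^{n̄+1}·θ^{(1−β′)(n̄+1)}·4e²θ^{β′}(D+1)·|W|` (the `(n̄+1)!` of the block bound cancels the printed `1/(n̄+1)!`;
`∫₀¹ (1−t)^{n̄} ≤ 1`); hypotheses: (5.14.4) for the slot data of every assignment at every `t ∈ (0,1]`, gen 5's regime — nothing structural.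
[cite: BalabanImbrieJaffe1988, (5.14.2) p.308; (5.14.4) p.309; p.310 (Sect. 5.14)] -/
theorem abs_remR_sum_Tsum_le_of_ineq5144 (hR : ∀ x y, adj x y → adj y x) (hD : ∀ x, (nbr x).card ≤ D)
    (hnbr : ∀ x y, adj x y → y ∈ nbr x) (hθ0 : 0 < θ) (hθ1 : θ ≤ 1) (hβ : 0 ≤ β')
    (hsmall : 16 * ((D : ℝ) + 1) ^ 2 * (θ ^ (β' / 2) * Real.exp 2) ≤ 1) {nbar : ℕ} (hL : Fintype.card L = nbar + 1)
    (h5144 : ∀ t ∈ Set.Ioc (0 : ℝ) 1, ∀ γ : L → ↥B ⊕ ↥Ys, Ineq5144 (cubeSys I) (Finset L)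
      (prime (g3 adj fun H' => zG blk Δ ℱ (fD (uD χ p ek B Φ c Ys V t) cube γ H')))
      Finset.card (fun H (X : Finset I) => (X \ H.image (cube ∘ γ)).card) θ β') :
    |remR (fun t => ∑ γ : L → ↥B ⊕ ↥Ys, Tsum ((polysOf W).image (cvsupp adj W)) (locv (cube ∘ γ))
        (wv (prime (g3 adj fun H' => zG blk Δ ℱ (fD (uD χ p ek B Φ c Ys V t) cube γ H')))) univ) nbar| ≤
      (Fintype.card (L → ↥B ⊕ ↥Ys) : ℝ) * ((θ ^ (1 - β')) ^ (nbar + 1) * (2 * (2 * Real.exp 2 * θ ^ β' * ((D : ℝ) + 1)) * W.card)) := by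
  haveI : Nonempty L := Fintype.card_pos_iff.1 (by omega)
  set Kc : ℝ := 2 * (2 * Real.exp 2 * θ ^ β' * ((D : ℝ) + 1)) * W.card with hKc
  set Ns : ℝ := (Fintype.card (L → ↥B ⊕ ↥Ys) : ℝ) with hNs
  have hKc0 : 0 ≤ Kc := by rw [hKc]; positivity
  have hθ' : 0 ≤ (θ ^ (1 - β')) ^ (nbar + 1) := pow_nonneg (Real.rpow_nonneg hθ0.le _) _
  -- the uniform bound on the assignment-summed truncated function on `(0,1]`
  have hbound : ∀ t ∈ Set.Ioc (0 : ℝ) 1,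
      |∑ γ : L → ↥B ⊕ ↥Ys, Tsum ((polysOf W).image (cvsupp adj W)) (locv (cube ∘ γ))
          (wv (prime (g3 adj fun H' => zG blk Δ ℱ (fD (uD χ p ek B Φ c Ys V t) cube γ H')))) univ| ≤
        Ns * ((θ ^ (1 - β')) ^ (nbar + 1) * (nbar + 1).factorial * Kc) := by
    intro t ht
    refine (abs_sum_le_sum_abs _ _).trans ?_
    calc ∑ γ : L → ↥B ⊕ ↥Ys, |Tsum ((polysOf W).image (cvsupp adj W)) (locv (cube ∘ γ))
            (wv (prime (g3 adj fun H' => zG blk Δ ℱ (fD (uD χ p ek B Φ c Ys V t) cube γ H')))) univ|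
        ≤ ∑ _γ : L → ↥B ⊕ ↥Ys, (θ ^ (1 - β')) ^ (nbar + 1) * (nbar + 1).factorial * Kc :=
          sum_le_sum fun γ _ => by
            have h := abs_Tsum_slot_le_of_ineq5144 blk Δ ℱ W adj χ cube hR hD hnbr hθ0 hθ1 hβ hsmall t γ (h5144 t ht γ)
              (univ_nonempty (α := L))
            rwa [card_univ, hL] at h
      _ = Ns * ((θ ^ (1 - β')) ^ (nbar + 1) * (nbar + 1).factorial * Kc) := by rw [sum_const, card_univ, nsmul_eq_mul]
  -- the `t`-integral against the printed weight `(1−t)^{n̄}/(n̄+1)!`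
  have hw1 : ∀ x ∈ Set.Ioc (0 : ℝ) 1, |(1 - x) ^ nbar / ((nbar + 1).factorial : ℝ)| ≤ 1 / (nbar + 1).factorial := by
    intro x hx
    rw [abs_div, Nat.abs_cast, abs_pow]
    refine div_le_div_of_nonneg_right ?_ (by positivity)
    exact pow_le_one₀ (abs_nonneg _) (by rw [abs_le]; constructor <;> linarith [hx.1, hx.2])
  have key : ∀ x ∈ Set.uIoc (0 : ℝ) 1,
      ‖-((1 - x) ^ nbar / ((nbar + 1).factorial : ℝ)) * ∑ γ : L → ↥B ⊕ ↥Ys, Tsum ((polysOf W).image (cvsupp adj W)) (locv (cube ∘ γ))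
          (wv (prime (g3 adj fun H' => zG blk Δ ℱ (fD (uD χ p ek B Φ c Ys V x) cube γ H')))) univ‖ ≤
        1 / (nbar + 1).factorial * (Ns * ((θ ^ (1 - β')) ^ (nbar + 1) * (nbar + 1).factorial * Kc)) := by
    intro x hx
    rw [Set.uIoc_of_le zero_le_one] at hx
    rw [norm_mul, Real.norm_eq_abs, Real.norm_eq_abs, abs_neg]
    exact mul_le_mul (hw1 x hx) (hbound x hx) (abs_nonneg _) (by positivity)
  have hint := intervalIntegral.norm_integral_le_of_norm_le_const key
  rw [Real.norm_eq_abs, sub_zero, abs_one, mul_one] at hint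
  unfold remR
  refine hint.trans (le_of_eq ?_)
  have hf : ((nbar + 1).factorial : ℝ) ≠ 0 := by positivity
  field_simp

end Literature.MathematicalPhysics.QuantumFieldTheory.BalabanImbrieJaffe1984to88.BIJ88SlotConnectedGraph310KP

end
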